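import Literature.Analysis.FluidPDE.FujitaKatoDictionary
import Literature.Analysis.FluidPDE.KatoL3Uniqueness
import HarnessLib

/-!
# Fourier data of the tensor `v ⊗ v` of a bounded `C([0,T]; L³)` field

Second file of the discharge of `Literature.Analysis.FluidPDE.bounded_mild_fujitaKato_persistence`
(`RusinSverakRhoMaxPureLe.lean`). For a field `v : ℝ → ℝ³ → ℝ³` bounded everywhere by `M` and
continuous on `[0, T]` with values in `L³(ℝ³)`, the tensors `v(τ) ⊗ v(τ)` form a continuous
path in `L²(ℝ³; ℝ^{3×3})` (`‖v ⊗ v - w ⊗ w‖₂ ≤ (2M)^{1/2} ‖|v|+|w|‖₃^{1/2} ‖v - w‖₃`, Hölder), whose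
`L²` Fourier transforms therefore admit a jointly measurable version
(`Literature.Analysis.FunctionSpaces.exists_measurable_uncurry_of_continuousOn_Lp`); reflecting
and symmetrising it gives a **tensor coefficient field** `q : ℝ → ℝ³ → (Fin 3 → Fin 3 → ℂ)`
(the input of `PersistenceFourierDuhamel.lean`) with

* joint measurability and the uniform bound `∫ ‖q(τ, ζ)‖² dζ ≤ K₂ < ∞` on `[0, T]` (Plancherel);
* Hermitian symmetry `q(τ, -ζ)_{jk} = conj q(τ, ζ)_{jk}` at **every** `(τ, ζ)` (reality of
  `v ⊗ v`, Mathlib/tree `fourier_neg_apply_eq_conj`, then symmetrisation on a null set);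
* the **quadratic pairing** `∫ θ(x) v_j(τ,x) v_k(τ,x) dx = ∫ 𝓕θ(ζ) q(τ, ζ)_{jk} dζ` for Schwartz `θ`
  (Plancherel duality `∫ φ • 𝓕f = ∫ 𝓕φ • f`, tree `integral_smul_fourier_eq`, with `φ = 𝓕⁻¹θ`
  and the reflection `ζ ↦ -ζ`), the replacement of the convolution pairing
  `FujitaKato.DictHyp.quad` of the Fujita–Kato dictionary (Lemarié-Rieusset 2023, §8.7 (8.8):
  the transform of `u ⊗ u`).

Everything is proved; no named facts.

## Mathlib / tree search

Mathlib: `eLpNorm_smul_le_mul_eLpNorm` (Hölder), `eLpNorm_norm_rpow`,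
`eLpNorm_le_mul_eLpNorm_of_ae_le_mul`, `MeasureTheory.Lp.norm_fourier_eq`,
`SchwartzMap.fourierInv_coe`, `Real.fourierInv_eq_fourier_neg`, `fourier_fourierInv_eq`,
`integral_neg_eq_self`, `ContinuousLinearMap.integral_comp_comm`. Tree: `integral_smul_fourier_eq`,
`integrable_schwartz_smul`, `fourier_neg_apply_eq_conj`, `FujitaKato.ae_comp_neg`
(`FujitaKatoLocal.lean`), `ContinuousInLpOn.exists_forall_eLpNorm_le` (`KatoL3Uniqueness.lean`),
`exists_measurable_uncurry_of_continuousOn_Lp` (`LpJointMeasurable.lean`),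
`EuclideanSpace.complexify` (`Complexify.lean`).

## References

* P. G. Lemarié-Rieusset, *The Navier–Stokes problem in the 21st century*, 2nd ed., CRC Press
  2023, §8.7 (8.8) (PDF p. 198). [Lemarierieusset2023]
-/

noncomputable section

open MeasureTheory Set Function Filter Topology Real FourierTransform
open scoped ENNReal NNReal ComplexConjugate

namespace Literature.Analysis.FluidPDE.Persistence

open FujitaKato Literature.Analysis.FunctionSpaces
open FunctionSpaces.EuclideanSpace (complexify complexify_apply norm_complexify continuous_complexify)

/-- Local notation for physical / frequency space `ℝ³ = EuclideanSpace ℝ (Fin 3)`. -/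
local notation "ℝ³" => EuclideanSpace ℝ (Fin 3)

/-- Local notation for real `3 × 3` tensors as a Euclidean space. -/
local notation "𝕋" => EuclideanSpace ℝ (Fin 3 × Fin 3)

/-- Local notation for complex `3 × 3` tensors as a Euclidean space. -/
local notation "𝕋ℂ" => EuclideanSpace ℂ (Fin 3 × Fin 3)

/-! ### The tensor product of two vectors as a Euclidean vector indexed by pairs -/

section TensorProd

/-- The tensor product `v ⊗ w = (v_j w_k)_{(j,k)}` of two vectors of `ℝ³`, as a vector of the
Euclidean space indexed by `Fin 3 × Fin 3` (so that `‖v ⊗ w‖ = ‖v‖ ‖w‖`). [folklore] -/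
def tensorProd (v w : ℝ³) : 𝕋 := WithLp.toLp 2 fun p => v p.1 * w p.2

/-- Coordinates of `tensorProd`. [folklore] -/
@[simp]
theorem tensorProd_apply (v w : ℝ³) (p : Fin 3 × Fin 3) : tensorProd v w p = v p.1 * w p.2 := rfl

/-- `‖v ⊗ w‖ = ‖v‖ ‖w‖` (the Euclidean norm of the tensor factors). [folklore] -/
theorem norm_tensorProd (v w : ℝ³) : ‖tensorProd v w‖ = ‖v‖ * ‖w‖ := by
  rw [EuclideanSpace.norm_eq, EuclideanSpace.norm_eq v, EuclideanSpace.norm_eq w,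
    ← Real.sqrt_mul (Finset.sum_nonneg fun i _ => sq_nonneg _), Fintype.sum_prod_type, Finset.sum_mul_sum]
  congr 1
  refine Finset.sum_congr rfl fun j _ => Finset.sum_congr rfl fun k _ => ?_
  rw [tensorProd_apply, norm_mul, mul_pow]

/-- `v ⊗ v - w ⊗ w = v ⊗ (v - w) + (v - w) ⊗ w`. [folklore] -/
theorem tensorProd_self_sub (v w : ℝ³) :
    tensorProd v v - tensorProd w w = tensorProd v (v - w) + tensorProd (v - w) w := by
  ext p
  simp only [PiLp.sub_apply, PiLp.add_apply, tensorProd_apply]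
  ring

/-- `‖v ⊗ v - w ⊗ w‖ ≤ (‖v‖ + ‖w‖) ‖v - w‖`. [folklore] -/
theorem norm_tensorProd_self_sub_le (v w : ℝ³) :
    ‖tensorProd v v - tensorProd w w‖ ≤ (‖v‖ + ‖w‖) * ‖v - w‖ := by
  rw [tensorProd_self_sub]
  refine (norm_add_le _ _).trans (le_of_eq ?_)
  rw [norm_tensorProd, norm_tensorProd]
  ring

/-- `tensorProd` is continuous. [folklore] -/
theorem continuous_tensorProd : Continuous fun p : ℝ³ × ℝ³ => tensorProd p.1 p.2 := by
  refine (PiLp.continuous_toLp 2 _).comp (continuous_pi fun q => ?_)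
  exact ((EuclideanSpace.proj q.1).continuous.comp continuous_fst).mul
    ((EuclideanSpace.proj q.2).continuous.comp continuous_snd)

/-- Coordinates of the complexified tensor: `(v ⊗ w)^ℂ_{(j,k)} = (v_j w_k : ℂ)`. [folklore] -/
theorem complexify_tensorProd_apply (v w : ℝ³) (p : Fin 3 × Fin 3) :
    complexify (tensorProd v w) p = ((v p.1 * w p.2 : ℝ) : ℂ) := by
  rw [complexify_apply, tensorProd_apply]

end TensorProd

/-! ### The `L²` size of `v ⊗ v - w ⊗ w` for bounded `L³` fields -/

section L2

/-- The Hölder triple `(6, 3, 2)`: `6⁻¹ + 3⁻¹ = 2⁻¹`. [folklore] -/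
theorem holderTriple_six_three_two : ENNReal.HolderTriple 6 3 2 := by
  refine ⟨?_⟩
  have h : ENNReal.ofReal 6⁻¹ + ENNReal.ofReal 3⁻¹ = ENNReal.ofReal 2⁻¹ := by
    rw [← ENNReal.ofReal_add (by positivity) (by positivity)]
    norm_num
  rw [ENNReal.ofReal_inv_of_pos (by norm_num), ENNReal.ofReal_inv_of_pos (by norm_num),
    ENNReal.ofReal_inv_of_pos (by norm_num), ENNReal.ofReal_ofNat, ENNReal.ofReal_ofNat,
    ENNReal.ofReal_ofNat] at h
  exact h

/-- `6 · (1/2) = 3` in `ℝ≥0∞` (the exponent bookkeeping of `‖s^{1/2}‖₆ = ‖s‖₃^{1/2}`). [folklore] -/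
theorem six_mul_ofReal_half : (6 : ℝ≥0∞) * ENNReal.ofReal (1 / 2) = 3 := by
  rw [one_div, ENNReal.ofReal_inv_of_pos two_pos, ENNReal.ofReal_ofNat,
    show (6 : ℝ≥0∞) = 3 * 2 by norm_num, mul_assoc, ENNReal.mul_inv_cancel two_ne_zero ENNReal.ofNat_ne_top, mul_one]

/-- **The `L²` size of `v ⊗ v - w ⊗ w` for fields bounded by `M`**:
`‖f ⊗ f - g ⊗ g‖_{L²} ≤ (2M)^{1/2} ‖|f| + |g|‖_{L³}^{1/2} ‖f - g‖_{L³}` (pointwise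
`‖f ⊗ f - g ⊗ g‖ ≤ (|f|+|g|) |f-g| ≤ (2M)^{1/2} (|f|+|g|)^{1/2} |f-g|`, then Hölder `L⁶ × L³ → L²`
and `‖s^{1/2}‖_{L⁶} = ‖s‖_{L³}^{1/2}`). [folklore] -/
theorem eLpNorm_tensorProd_self_sub_le {f g : ℝ³ → ℝ³} (hf : AEStronglyMeasurable f volume)
    (hg : AEStronglyMeasurable g volume) {M : ℝ} (hfM : ∀ x, ‖f x‖ ≤ M) (hgM : ∀ x, ‖g x‖ ≤ M) :
    eLpNorm (fun x => tensorProd (f x) (f x) - tensorProd (g x) (g x)) 2 volume ≤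
      ENNReal.ofReal ((2 * M) ^ (1 / 2 : ℝ)) *
        (eLpNorm (fun x => ‖f x‖ + ‖g x‖) 3 volume ^ (1 / 2 : ℝ) * eLpNorm (f - g) 3 volume) := by
  haveI : ENNReal.HolderTriple 6 3 2 := holderTriple_six_three_two
  set s : ℝ³ → ℝ := fun x => ‖f x‖ + ‖g x‖ with hs
  set φ : ℝ³ → ℝ := fun x => s x ^ (1 / 2 : ℝ) with hφ
  set d : ℝ³ → ℝ := fun x => ‖f x - g x‖ with hd
  have hs0 : ∀ x, 0 ≤ s x := fun x => by positivity
  have hsM : ∀ x, s x ≤ 2 * M := fun x => by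
    have := hfM x; have := hgM x; rw [hs]; dsimp only; linarith
  have hφ0 : ∀ x, 0 ≤ φ x := fun x => Real.rpow_nonneg (hs0 x) _
  -- pointwise domination
  have hpt : ∀ x, ‖tensorProd (f x) (f x) - tensorProd (g x) (g x)‖ ≤ (2 * M) ^ (1 / 2 : ℝ) * ‖φ x * d x‖ := by
    intro x
    have h1 := norm_tensorProd_self_sub_le (f x) (g x)
    have hsplit : s x = φ x * φ x := by
      rw [hφ]
      dsimp only
      rw [← Real.rpow_add' (hs0 x) (by norm_num)]
      norm_num
    have hφM : φ x ≤ (2 * M) ^ (1 / 2 : ℝ) := Real.rpow_le_rpow (hs0 x) (hsM x) (by norm_num)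
    rw [Real.norm_of_nonneg (mul_nonneg (hφ0 x) (norm_nonneg _))]
    calc ‖tensorProd (f x) (f x) - tensorProd (g x) (g x)‖ ≤ s x * d x := h1
      _ = φ x * (φ x * d x) := by rw [hsplit, mul_assoc]
      _ ≤ (2 * M) ^ (1 / 2 : ℝ) * (φ x * d x) :=
          mul_le_mul_of_nonneg_right hφM (mul_nonneg (hφ0 x) (norm_nonneg _))
  -- measurability
  have hsm : AEStronglyMeasurable s volume := hf.norm.add hg.norm
  have hφm : AEStronglyMeasurable φ volume := (hsm.aemeasurable.pow_const _).aestronglyMeasurable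
  have hdm : AEStronglyMeasurable d volume := (hf.sub hg).norm
  -- Hölder
  have hH : eLpNorm (fun x => φ x * d x) 2 volume ≤ eLpNorm φ 6 volume * eLpNorm d 3 volume := by
    have h := eLpNorm_smul_le_mul_eLpNorm (p := 6) (q := 3) (r := 2) hdm hφm
    exact h
  -- `‖φ‖₆ = ‖s‖₃^{1/2}`
  have hφ6 : eLpNorm φ 6 volume = eLpNorm s 3 volume ^ (1 / 2 : ℝ) := by
    have h := eLpNorm_norm_rpow s (by norm_num : (0 : ℝ) < 1 / 2) (p := 6) (μ := volume)
    rw [six_mul_ofReal_half] at h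
    rw [← h, hφ]
    refine eLpNorm_congr_ae (Eventually.of_forall fun x => ?_)
    dsimp only
    rw [Real.norm_of_nonneg (hs0 x)]
  have hd3 : eLpNorm d 3 volume = eLpNorm (f - g) 3 volume := by
    rw [hd, eLpNorm_norm]
    rfl
  calc eLpNorm (fun x => tensorProd (f x) (f x) - tensorProd (g x) (g x)) 2 volume
      ≤ ENNReal.ofReal ((2 * M) ^ (1 / 2 : ℝ)) * eLpNorm (fun x => φ x * d x) 2 volume :=
        eLpNorm_le_mul_eLpNorm_of_ae_le_mul (Eventually.of_forall hpt) 2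
    _ ≤ ENNReal.ofReal ((2 * M) ^ (1 / 2 : ℝ)) * (eLpNorm φ 6 volume * eLpNorm d 3 volume) := by gcongr
    _ = _ := by rw [hφ6, hd3]

/-- The `L³` size of `|f| + |g|` is at most `‖f‖₃ + ‖g‖₃`. [folklore] -/
theorem eLpNorm_norm_add_norm_le {f g : ℝ³ → ℝ³} (hf : AEStronglyMeasurable f volume)
    (hg : AEStronglyMeasurable g volume) :
    eLpNorm (fun x => ‖f x‖ + ‖g x‖) 3 volume ≤ eLpNorm f 3 volume + eLpNorm g 3 volume := by
  calc eLpNorm (fun x => ‖f x‖ + ‖g x‖) 3 volume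
      ≤ eLpNorm (fun x => ‖f x‖) 3 volume + eLpNorm (fun x => ‖g x‖) 3 volume :=
        eLpNorm_add_le hf.norm hg.norm (by norm_num)
    _ = eLpNorm f 3 volume + eLpNorm g 3 volume := by rw [eLpNorm_norm, eLpNorm_norm]

end L2

/-! ### Hermitian symmetry of the Fourier transform of a real field (two index types) -/

section Reality

open SchwartzMap

variable {ι κ : Type*} [Fintype ι] [Fintype κ]

/-- **Hermitian symmetry on the Fourier side**, for a real field with different domain and target
index types: the `L²` Fourier transform `F̂` of a complexified real field
`F : ℝ^ι → ℝ^κ`, `F ∈ L²`, satisfies `F̂(-ξ)ⱼ = conj F̂(ξ)ⱼ` for a.e. `ξ` and every `j : κ`. The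
proof of the tree's `fourier_neg_apply_eq_conj` (`FujitaKatoLocal.lean`, the case `κ = ι`)
verbatim: both sides are tested against real smooth compactly supported `θ` through the duality
`∫ θ · 𝓕f = ∫ 𝓕θ · f`, the reflection `𝓕(θ ∘ neg) = 𝓕⁻θ` and `conj (𝓕 θ) = 𝓕⁻ (conj θ)`, then
`ae_eq_of_integral_contDiff_smul_eq` (Grafakos, *Classical Fourier Analysis*, Prop. 2.2.11). [folklore] -/
theorem fourier_neg_apply_eq_conj₂ (u₀ : EuclideanSpace ℝ ι → EuclideanSpace ℝ κ)
    (hu₀ : MemLp (FunctionSpaces.EuclideanSpace.complexify ∘ u₀) 2 (volume : Measure (EuclideanSpace ℝ ι))) :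
    ∀ᵐ ξ : EuclideanSpace ℝ ι ∂volume, ∀ j,
      ((𝓕 (hu₀.toLp (FunctionSpaces.EuclideanSpace.complexify ∘ u₀)) :
        Lp (EuclideanSpace ℂ κ) 2 (volume : Measure (EuclideanSpace ℝ ι))) :
          EuclideanSpace ℝ ι → EuclideanSpace ℂ κ) (-ξ) j =
      conj (((𝓕 (hu₀.toLp (FunctionSpaces.EuclideanSpace.complexify ∘ u₀)) :
        Lp (EuclideanSpace ℂ κ) 2 (volume : Measure (EuclideanSpace ℝ ι))) :
          EuclideanSpace ℝ ι → EuclideanSpace ℂ κ) ξ j) := by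
  set f : Lp (EuclideanSpace ℂ κ) 2 (volume : Measure (EuclideanSpace ℝ ι)) :=
    hu₀.toLp (FunctionSpaces.EuclideanSpace.complexify ∘ u₀) with hf
  set g : EuclideanSpace ℝ ι → EuclideanSpace ℂ κ :=
    ((𝓕 f : Lp (EuclideanSpace ℂ κ) 2 (volume : Measure (EuclideanSpace ℝ ι))) :
      EuclideanSpace ℝ ι → EuclideanSpace ℂ κ) with hg
  have hf_ae : (f : EuclideanSpace ℝ ι → EuclideanSpace ℂ κ) =ᵐ[volume]
      FunctionSpaces.EuclideanSpace.complexify ∘ u₀ := hu₀.coeFn_toLp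
  have hgL2 : MemLp g 2 volume := Lp.memLp _
  have hfL2 : MemLp (f : EuclideanSpace ℝ ι → EuclideanSpace ℂ κ) 2 volume := Lp.memLp _
  rw [ae_all_iff]
  intro j
  -- scalar slices
  set gj : EuclideanSpace ℝ ι → ℂ := fun ξ => g ξ j with hgj
  set fj : EuclideanSpace ℝ ι → ℂ := fun x => (f : EuclideanSpace ℝ ι → EuclideanSpace ℂ κ) x j
    with hfj
  have hfj_real : ∀ᵐ x ∂volume, conj (fj x) = fj x := by
    filter_upwards [hf_ae] with x hx
    simp [hfj, hx]
  -- duality, component `j`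
  have hdual : ∀ φ : 𝓢(EuclideanSpace ℝ ι, ℂ),
      ∫ ξ, φ ξ * gj ξ = ∫ x, 𝓕 (φ : EuclideanSpace ℝ ι → ℂ) x * fj x := by
    intro φ
    have h := congrArg (fun y : EuclideanSpace ℂ κ => y j) (integral_smul_fourier_eq f φ)
    have h1 := (EuclideanSpace.proj (𝕜 := ℂ) j).integral_comp_comm
      (integrable_schwartz_smul φ hgL2)
    have h2 := (EuclideanSpace.proj (𝕜 := ℂ) j).integral_comp_comm
      (integrable_schwartz_smul (𝓕 φ) hfL2)
    simp only [PiLp.proj_apply, WithLp.ofLp_smul, Pi.smul_apply, smul_eq_mul] at h1 h2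
    simp only at h
    rw [← h1, ← h2, SchwartzMap.fourier_coe] at h
    exact h
  -- the two sides of the symmetry, tested against real smooth compactly supported functions
  have hneg_int : ∀ φ : 𝓢(EuclideanSpace ℝ ι, ℂ),
      ∫ ξ, φ ξ * gj (-ξ) = ∫ x, 𝓕⁻ (φ : EuclideanSpace ℝ ι → ℂ) x * fj x := by
    intro φ
    set φn : 𝓢(EuclideanSpace ℝ ι, ℂ) :=
      SchwartzMap.compCLMOfContinuousLinearEquiv ℂ (ContinuousLinearEquiv.neg ℝ) φ with hφn
    have hφn_apply : ∀ ξ, φn ξ = φ (-ξ) := fun ξ => by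
      simp [hφn, SchwartzMap.compCLMOfContinuousLinearEquiv_apply]
    calc ∫ ξ, φ ξ * gj (-ξ) = ∫ ξ, φn (-ξ) * gj (-ξ) := by simp only [hφn_apply, neg_neg]
      _ = ∫ ξ, φn ξ * gj ξ := integral_neg_eq_self (fun ξ => φn ξ * gj ξ) volume
      _ = ∫ x, 𝓕 (φn : EuclideanSpace ℝ ι → ℂ) x * fj x := hdual φn
      _ = ∫ x, 𝓕⁻ (φ : EuclideanSpace ℝ ι → ℂ) x * fj x := by
          congr 1
          funext x
          rw [Real.fourierInv_eq_fourier_comp_neg,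
            show (fun ξ => φ (-ξ)) = (φn : EuclideanSpace ℝ ι → ℂ) from
              funext fun ξ => (hφn_apply ξ).symm]
  have hconj_int : ∀ φ : 𝓢(EuclideanSpace ℝ ι, ℂ), (∀ ξ, conj (φ ξ) = φ ξ) →
      ∫ ξ, φ ξ * conj (gj ξ) = ∫ x, 𝓕⁻ (φ : EuclideanSpace ℝ ι → ℂ) x * fj x := by
    intro φ hφ
    calc ∫ ξ, φ ξ * conj (gj ξ) = ∫ ξ, conj (conj (φ ξ) * gj ξ) := by
            simp only [map_mul, Complex.conj_conj]
      _ = conj (∫ ξ, conj (φ ξ) * gj ξ) := integral_conj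
      _ = conj (∫ ξ, φ ξ * gj ξ) := by simp_rw [hφ]
      _ = conj (∫ x, 𝓕 (φ : EuclideanSpace ℝ ι → ℂ) x * fj x) := by rw [hdual φ]
      _ = ∫ x, conj (𝓕 (φ : EuclideanSpace ℝ ι → ℂ) x * fj x) := integral_conj.symm
      _ = ∫ x, 𝓕⁻ (φ : EuclideanSpace ℝ ι → ℂ) x * fj x := by
          refine integral_congr_ae ?_
          filter_upwards [hfj_real] with x hx
          rw [map_mul, hx, conj_fourier_schwartz,
            show (fun v => conj (φ v)) = (φ : EuclideanSpace ℝ ι → ℂ) from funext hφ]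
  -- conclude with the fundamental lemma of the calculus of variations
  have hgjL2 : MemLp gj 2 volume := by
    have := (EuclideanSpace.proj (𝕜 := ℂ) j).comp_memLp' hgL2
    simpa [hgj, Function.comp_def] using this
  have hnegL2 : MemLp (fun ξ => gj (-ξ)) 2 volume :=
    hgjL2.comp_measurePreserving (Measure.measurePreserving_neg volume)
  have hconjL2 : MemLp (fun ξ => conj (gj ξ)) 2 volume := by
    have := (Complex.conjCLE : ℂ ≃L[ℝ] ℂ).toContinuousLinearMap.comp_memLp' hgjL2
    simpa [Function.comp_def] using this
  have hae : ∀ᵐ ξ ∂volume, gj (-ξ) = conj (gj ξ) := by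
    refine ae_eq_of_integral_contDiff_smul_eq (hnegL2.locallyIntegrable one_le_two)
      (hconjL2.locallyIntegrable one_le_two) fun θ hθ hθc => ?_
    have hθC : ContDiff ℝ (⊤ : ℕ∞) (fun x => (θ x : ℂ)) := Complex.ofRealCLM.contDiff.comp hθ
    have hθCc : HasCompactSupport (fun x => (θ x : ℂ)) := hθc.comp_left Complex.ofReal_zero
    set φ : 𝓢(EuclideanSpace ℝ ι, ℂ) := hθCc.toSchwartzMap hθC with hφ
    have hφ_apply : ∀ x, φ x = (θ x : ℂ) := fun x => rfl
    have hφreal : ∀ ξ, conj (φ ξ) = φ ξ := fun ξ => by rw [hφ_apply, Complex.conj_ofReal]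
    have h1 : ∫ x, θ x • gj (-x) = ∫ x, φ x * gj (-x) := by
      simp_rw [hφ_apply, Complex.real_smul]
    have h2 : ∫ x, θ x • conj (gj x) = ∫ x, φ x * conj (gj x) := by
      simp_rw [hφ_apply, Complex.real_smul]
    rw [h1, h2, hneg_int φ, hconj_int φ hφreal]
  filter_upwards [hae] with ξ hξ
  simpa [hgj] using hξ

end Reality

/-! ### The tensor field of a bounded `C([0,T]; L³)` field -/

section Field

variable {v : ℝ → ℝ³ → ℝ³} {M T : ℝ}

/-- The tensor field `τ ↦ v(τ) ⊗ v(τ)`. [folklore] -/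
def tensorField (v : ℝ → ℝ³ → ℝ³) (τ : ℝ) (x : ℝ³) : 𝕋 := tensorProd (v τ x) (v τ x)

/-- Unfolding `tensorField`. [folklore] -/
theorem tensorField_apply (v : ℝ → ℝ³ → ℝ³) (τ : ℝ) (x : ℝ³) : tensorField v τ x = tensorProd (v τ x) (v τ x) := rfl

/-- Slices of the tensor field are a.e. strongly measurable. [folklore] -/
theorem aestronglyMeasurable_tensorField {τ : ℝ} (hv : AEStronglyMeasurable (v τ) volume) :
    AEStronglyMeasurable (tensorField v τ) volume :=
  continuous_tensorProd.comp_aestronglyMeasurable (hv.prodMk hv)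

/-- **Standing hypotheses on the field**: bounded everywhere by `M ≥ 0` and in `C([0,T]; L³)`. [folklore] -/
structure FieldHyp (v : ℝ → ℝ³ → ℝ³) (M T : ℝ) : Prop where
  /-- The bound is nonnegative. -/
  M_nonneg : 0 ≤ M
  /-- The field is bounded everywhere. -/
  bound : ∀ τ x, ‖v τ x‖ ≤ M
  /-- The field is in `C([0,T]; L³)`. -/
  cont : ContinuousInLpOn (Icc 0 T) 3 v

namespace FieldHyp

variable (h : FieldHyp v M T)
include h

/-- Slices on `[0, T]` are in `L³`. [folklore] -/
theorem memLp_three {τ : ℝ} (hτ : τ ∈ Icc 0 T) : MemLp (v τ) 3 volume := h.cont.1 τ hτ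

/-- Slices on `[0, T]` are a.e. strongly measurable. [folklore] -/
theorem aesm {τ : ℝ} (hτ : τ ∈ Icc 0 T) : AEStronglyMeasurable (v τ) volume := (h.memLp_three hτ).1

/-- A uniform `L³` bound on `[0, T]`. [folklore] -/
theorem exists_bound_three : ∃ L : ℝ≥0, ∀ τ ∈ Icc 0 T, eLpNorm (v τ) 3 volume ≤ L :=
  h.cont.exists_forall_eLpNorm_le (by norm_num) isCompact_Icc Subset.rfl

/-- The chosen uniform `L³` bound. [folklore] -/
def L3 : ℝ≥0 := h.exists_bound_three.choose

/-- The bound bounds. [folklore] -/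
theorem eLpNorm_three_le {τ : ℝ} (hτ : τ ∈ Icc 0 T) : eLpNorm (v τ) 3 volume ≤ h.L3 :=
  h.exists_bound_three.choose_spec τ hτ

/-- **The `L²` distance of two tensor slices** on `[0, T]`:
`‖v(τ)⊗v(τ) - v(τ₀)⊗v(τ₀)‖₂ ≤ (2M)^{1/2} (2L)^{1/2} ‖v(τ) - v(τ₀)‖₃`. [folklore] -/
theorem eLpNorm_tensorField_sub_le {τ τ₀ : ℝ} (hτ : τ ∈ Icc 0 T) (hτ₀ : τ₀ ∈ Icc 0 T) :
    eLpNorm (tensorField v τ - tensorField v τ₀) 2 volume ≤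
      ENNReal.ofReal ((2 * M) ^ (1 / 2 : ℝ)) * (((h.L3 : ℝ≥0∞) + h.L3) ^ (1 / 2 : ℝ) *
        eLpNorm (v τ - v τ₀) 3 volume) := by
  have h1 := eLpNorm_tensorProd_self_sub_le (h.aesm hτ) (h.aesm hτ₀) (h.bound τ) (h.bound τ₀)
  refine (le_of_eq (eLpNorm_congr_ae (Eventually.of_forall fun x => rfl))).trans (h1.trans ?_)
  gcongr
  exact (eLpNorm_norm_add_norm_le (h.aesm hτ) (h.aesm hτ₀)).trans (add_le_add (h.eLpNorm_three_le hτ) (h.eLpNorm_three_le hτ₀))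

/-- **The tensor slices are in `L²`** on `[0, T]`, with the uniform bound
`‖v(τ)⊗v(τ)‖₂ ≤ (2M)^{1/2} (2L)^{1/2} L`. [folklore] -/
theorem eLpNorm_tensorField_le {τ : ℝ} (hτ : τ ∈ Icc 0 T) :
    eLpNorm (tensorField v τ) 2 volume ≤
      ENNReal.ofReal ((2 * M) ^ (1 / 2 : ℝ)) * (((h.L3 : ℝ≥0∞) + h.L3) ^ (1 / 2 : ℝ) * h.L3) := by
  have hz : AEStronglyMeasurable (fun _ : ℝ³ => (0 : ℝ³)) volume := aestronglyMeasurable_const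
  have h1 := eLpNorm_tensorProd_self_sub_le (h.aesm hτ) hz (h.bound τ)
    (fun _ => by rw [norm_zero]; exact h.M_nonneg)
  have h0 : tensorProd (0 : ℝ³) 0 = 0 := by ext p; simp
  have heq : (fun x => tensorProd (v τ x) (v τ x) - tensorProd ((fun _ : ℝ³ => (0 : ℝ³)) x) ((fun _ : ℝ³ => (0 : ℝ³)) x)) =
      tensorField v τ := by
    funext x
    rw [tensorField_apply, h0, sub_zero]
  rw [heq] at h1
  refine h1.trans ?_
  gcongr
  · calc eLpNorm (fun x => ‖v τ x‖ + ‖(fun _ : ℝ³ => (0 : ℝ³)) x‖) 3 volume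
          ≤ eLpNorm (v τ) 3 volume + eLpNorm (fun _ : ℝ³ => (0 : ℝ³)) 3 volume := eLpNorm_norm_add_norm_le (h.aesm hτ) hz
        _ ≤ h.L3 + h.L3 := add_le_add (h.eLpNorm_three_le hτ) (by simp)
  · calc eLpNorm (v τ - fun _ => 0) 3 volume = eLpNorm (v τ) 3 volume := by
          rw [show (v τ - fun _ => (0 : ℝ³)) = v τ from sub_zero (v τ)]
      _ ≤ h.L3 := h.eLpNorm_three_le hτ

/-- The uniform `L²` bound of the tensor slices, as a constant. [folklore] -/
def K : ℝ≥0∞ := ENNReal.ofReal ((2 * M) ^ (1 / 2 : ℝ)) * (((h.L3 : ℝ≥0∞) + h.L3) ^ (1 / 2 : ℝ) * h.L3)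

/-- `K < ∞`. [folklore] -/
theorem K_lt_top : h.K < ∞ :=
  ENNReal.mul_lt_top ENNReal.ofReal_lt_top (ENNReal.mul_lt_top
    (ENNReal.rpow_lt_top_of_nonneg (by norm_num) (by simp)) ENNReal.coe_lt_top)

/-- The tensor slices are in `L²` on `[0, T]`. [folklore] -/
theorem memLp_tensorField {τ : ℝ} (hτ : τ ∈ Icc 0 T) : MemLp (tensorField v τ) 2 volume :=
  ⟨aestronglyMeasurable_tensorField (h.aesm hτ), (h.eLpNorm_tensorField_le hτ).trans_lt h.K_lt_top⟩

/-- **Continuity of the tensor path in `L²`** on `[0, T]`. [folklore] -/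
theorem tendsto_eLpNorm_tensorField_sub {τ₀ : ℝ} (hτ₀ : τ₀ ∈ Icc 0 T) :
    Tendsto (fun τ => eLpNorm (tensorField v τ - tensorField v τ₀) 2 volume) (𝓝[Icc 0 T] τ₀) (𝓝 0) := by
  set C : ℝ≥0∞ := ENNReal.ofReal ((2 * M) ^ (1 / 2 : ℝ)) * ((h.L3 : ℝ≥0∞) + h.L3) ^ (1 / 2 : ℝ) with hC
  have hCtop : C ≠ ∞ := ENNReal.mul_ne_top ENNReal.ofReal_ne_top
    (ENNReal.rpow_ne_top_of_nonneg (by norm_num) (by simp))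
  have hlim : Tendsto (fun τ => C * eLpNorm (v τ - v τ₀) 3 volume) (𝓝[Icc 0 T] τ₀) (𝓝 0) := by
    have := ENNReal.Tendsto.const_mul (h.cont.2 τ₀ hτ₀) (a := C) (Or.inr hCtop)
    rwa [mul_zero] at this
  refine tendsto_of_tendsto_of_tendsto_of_le_of_le' tendsto_const_nhds hlim
    (Eventually.of_forall fun _ => bot_le) ?_
  filter_upwards [self_mem_nhdsWithin] with τ hτ
  rw [hC, mul_assoc]
  exact h.eLpNorm_tensorField_sub_le hτ hτ₀

/-! ### The complexified tensor field and its Fourier class -/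

/-- The complexified tensor slices are in `L²` on `[0, T]`. [folklore] -/
theorem memLp_complexify_tensorField {τ : ℝ} (hτ : τ ∈ Icc 0 T) :
    MemLp (complexify ∘ tensorField v τ) 2 (volume : Measure ℝ³) :=
  MemLp.of_le (h.memLp_tensorField hτ)
    (continuous_complexify.comp_aestronglyMeasurable (h.memLp_tensorField hτ).1)
    (Eventually.of_forall fun x => by simp)

/-- **The Fourier class of the tensor slice**: `𝓕 (v(τ) ⊗ v(τ))^ℂ ∈ L²` on `[0, T]`, junk `0`
elsewhere. [folklore] -/
def fourierClass (τ : ℝ) : Lp 𝕋ℂ 2 (volume : Measure ℝ³) :=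
  if hτ : τ ∈ Icc 0 T then 𝓕 ((h.memLp_complexify_tensorField hτ).toLp _) else 0

/-- On `[0, T]` the Fourier class is the transform of the complexified slice. [folklore] -/
theorem fourierClass_eq {τ : ℝ} (hτ : τ ∈ Icc 0 T) :
    h.fourierClass τ = 𝓕 ((h.memLp_complexify_tensorField hτ).toLp _) := by
  rw [fourierClass, dif_pos hτ]

/-- The `L²` distance of two Fourier classes is the `L²` distance of the tensor slices
(Plancherel). [folklore] -/
theorem edist_fourierClass_eq {τ τ₀ : ℝ} (hτ : τ ∈ Icc 0 T) (hτ₀ : τ₀ ∈ Icc 0 T) :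
    edist (h.fourierClass τ) (h.fourierClass τ₀) = eLpNorm (tensorField v τ - tensorField v τ₀) 2 volume := by
  rw [h.fourierClass_eq hτ, h.fourierClass_eq hτ₀,
    show ∀ A B : Lp 𝕋ℂ 2 (volume : Measure ℝ³), edist ((𝓕 A : Lp 𝕋ℂ 2 (volume : Measure ℝ³)))
      ((𝓕 B : Lp 𝕋ℂ 2 (volume : Measure ℝ³))) = edist A B from fun A B =>
      (Lp.fourierTransformₗᵢ ℝ³ 𝕋ℂ).isometry.edist_eq A B, Lp.edist_toLp_toLp]
  refine eLpNorm_congr_norm_ae (Eventually.of_forall fun x => ?_)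
  simp only [Pi.sub_apply, Function.comp_apply, ← map_sub, norm_complexify]

/-- **Continuity of the Fourier classes** on `[0, T]`. [folklore] -/
theorem continuousOn_fourierClass : ContinuousOn h.fourierClass (Icc 0 T) := by
  intro τ₀ hτ₀
  rw [ContinuousWithinAt, EMetric.tendsto_nhds]
  intro ε hε
  filter_upwards [(tendsto_order.1 (h.tendsto_eLpNorm_tensorField_sub hτ₀)).2 ε hε, self_mem_nhdsWithin]
    with τ h1 h2
  rwa [h.edist_fourierClass_eq h2 hτ₀]

/-- A jointly measurable version of the Fourier classes exists. [folklore] -/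
theorem exists_version : ∃ g : ℝ → ℝ³ → 𝕋ℂ, Measurable (uncurry g) ∧
    ∀ τ ∈ Icc 0 T, g τ =ᵐ[volume] (h.fourierClass τ : ℝ³ → 𝕋ℂ) :=
  exists_measurable_uncurry_of_continuousOn_Lp _ h.continuousOn_fourierClass

/-- The chosen jointly measurable version `q₀`. [folklore] -/
def version : ℝ → ℝ³ → 𝕋ℂ := h.exists_version.choose

/-- The version is jointly measurable. [folklore] -/
theorem measurable_version : Measurable (uncurry h.version) := h.exists_version.choose_spec.1

/-- The version is the Fourier class at every `τ ∈ [0, T]`. [folklore] -/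
theorem version_ae_eq {τ : ℝ} (hτ : τ ∈ Icc 0 T) :
    h.version τ =ᵐ[volume] (h.fourierClass τ : ℝ³ → 𝕋ℂ) :=
  h.exists_version.choose_spec.2 τ hτ

/-! ### The tensor coefficient field -/

/-- **The tensor coefficient field** `q(τ, ζ)_{jk} = ½ (q₀(τ, -ζ)_{(j,k)} + conj q₀(τ, ζ)_{(j,k)})`:
the reflected version of the Fourier class (morally `𝓕⁻¹(v_j v_k)`), Hermitian-symmetrised so
that `q(τ, -ζ)_{jk} = conj q(τ, ζ)_{jk}` holds at every point (it holds a.e. before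
symmetrisation, by reality of `v ⊗ v`). [folklore] -/
def coeff (τ : ℝ) (ζ : ℝ³) (j k : Fin 3) : ℂ :=
  (h.version τ (-ζ) (j, k) + conj (h.version τ ζ (j, k))) / 2

/-- **Hermitian symmetry, everywhere.** [folklore] -/
theorem coeff_neg (τ : ℝ) (ζ : ℝ³) (j k : Fin 3) : h.coeff τ (-ζ) j k = conj (h.coeff τ ζ j k) := by
  simp only [coeff, neg_neg, map_div₀, map_add, Complex.conj_conj, map_ofNat]
  ring

/-- **Joint measurability** of the coefficient field. [folklore] -/
theorem measurable_coeff : Measurable (uncurry h.coeff) := by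
  have hm := h.measurable_version
  have hneg : Measurable fun p : ℝ × ℝ³ => h.version p.1 (-p.2) :=
    hm.comp (f := fun p : ℝ × ℝ³ => (p.1, -p.2)) (by fun_prop)
  refine measurable_pi_lambda _ fun j => measurable_pi_lambda _ fun k => ?_
  have h1 : Measurable fun p : ℝ × ℝ³ => h.version p.1 (-p.2) (j, k) :=
    (EuclideanSpace.proj (𝕜 := ℂ) (j, k)).measurable.comp hneg
  have h2 : Measurable fun p : ℝ × ℝ³ => conj (h.version p.1 p.2 (j, k)) :=
    Complex.continuous_conj.measurable.comp ((EuclideanSpace.proj (𝕜 := ℂ) (j, k)).measurable.comp hm)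
  exact (h1.add h2).div_const _

/-- **The coefficient field is the reflected Fourier transform**, a.e.: for `τ ∈ [0, T]`,
`q(τ, ζ)_{jk} = 𝓕[(v(τ)⊗v(τ))^ℂ](-ζ)_{(j,k)}` for a.e. `ζ` (reality: `𝓕F(-ξ) = conj 𝓕F(ξ)` for a
real field `F`, `fourier_neg_apply_eq_conj`). [folklore] -/
theorem coeff_ae_eq {τ : ℝ} (hτ : τ ∈ Icc 0 T) :
    ∀ᵐ ζ : ℝ³ ∂volume, ∀ j k, h.coeff τ ζ j k =
      ((𝓕 ((h.memLp_complexify_tensorField hτ).toLp _) : Lp 𝕋ℂ 2 (volume : Measure ℝ³)) : ℝ³ → 𝕋ℂ) (-ζ) (j, k) := by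
  set G : ℝ³ → 𝕋ℂ := ((𝓕 ((h.memLp_complexify_tensorField hτ).toLp _) : Lp 𝕋ℂ 2 (volume : Measure ℝ³)) : ℝ³ → 𝕋ℂ)
    with hG
  have hv : h.version τ =ᵐ[volume] G := by
    rw [hG, ← h.fourierClass_eq hτ]
    exact h.version_ae_eq hτ
  have hreal := fourier_neg_apply_eq_conj₂ (tensorField v τ) (h.memLp_complexify_tensorField hτ)
  filter_upwards [hv, ae_comp_neg hv, hreal] with ζ h1 h2 h3 j k
  rw [coeff, h1, h2, ← h3 (j, k)]
  ring

/-- **The uniform `L²` bound of the coefficient field** on `[0, T]`: `∫ ‖q(τ, ζ)‖² dζ ≤ K²`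
(coefficients are bounded by the Euclidean norm, reflection invariance, Plancherel). [folklore] -/
theorem lintegral_coeff_sq_le {τ : ℝ} (hτ : τ ∈ Icc 0 T) : ∫⁻ ζ, ‖h.coeff τ ζ‖ₑ ^ 2 ≤ h.K ^ 2 := by
  set Fτ := (h.memLp_complexify_tensorField hτ).toLp _ with hFτ
  set G : ℝ³ → 𝕋ℂ := ((𝓕 Fτ : Lp 𝕋ℂ 2 (volume : Measure ℝ³)) : ℝ³ → 𝕋ℂ) with hG
  -- coefficients vs Euclidean norm
  have hcoe : ∀ x : 𝕋ℂ, ‖(fun j k => x (j, k) : Fin 3 → Fin 3 → ℂ)‖ₑ ≤ ‖x‖ₑ := fun x => by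
    rw [← ofReal_norm, ← ofReal_norm]
    refine ENNReal.ofReal_le_ofReal ((pi_norm_le_iff_of_nonneg (norm_nonneg _)).2 fun j =>
      (pi_norm_le_iff_of_nonneg (norm_nonneg _)).2 fun k => ?_)
    exact PiLp.norm_apply_le x (j, k)
  have hae : ∀ᵐ ζ : ℝ³ ∂volume, ‖h.coeff τ ζ‖ₑ ^ 2 ≤ ‖G (-ζ)‖ₑ ^ 2 := by
    filter_upwards [h.coeff_ae_eq hτ] with ζ hζ
    have heq : h.coeff τ ζ = fun j k => G (-ζ) (j, k) := by
      funext j k; exact hζ j k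
    rw [heq]
    gcongr
    exact hcoe (G (-ζ))
  -- Plancherel: `∫⁻ ‖G‖² = ‖𝓕 Fτ‖ₑ² = ‖Fτ‖ₑ² = (eLpNorm (tensorField) 2)²`
  have hP : ∫⁻ ζ, ‖G ζ‖ₑ ^ 2 = eLpNorm (tensorField v τ) 2 volume ^ 2 := by
    have h1 : ∫⁻ ζ, ‖G ζ‖ₑ ^ 2 = eLpNorm G 2 volume ^ 2 := by
      rw [eLpNorm_eq_lintegral_rpow_enorm_toReal (by norm_num) (by norm_num)]
      simp only [ENNReal.toReal_ofNat, ENNReal.rpow_ofNat, one_div]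
      rw [← ENNReal.rpow_natCast, ← ENNReal.rpow_mul]
      norm_num
    have h2 : eLpNorm G 2 volume = ‖(𝓕 Fτ : Lp 𝕋ℂ 2 (volume : Measure ℝ³))‖ₑ := (Lp.enorm_def _).symm
    have h3 : ‖(𝓕 Fτ : Lp 𝕋ℂ 2 (volume : Measure ℝ³))‖ₑ = ‖Fτ‖ₑ := by
      rw [← ofReal_norm, ← ofReal_norm, Lp.norm_fourier_eq]
    have h4 : ‖Fτ‖ₑ = eLpNorm (tensorField v τ) 2 volume := by
      rw [hFτ, Lp.enorm_toLp]
      exact eLpNorm_congr_norm_ae (Eventually.of_forall fun x => by simp)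
    rw [h1, h2, h3, h4]
  calc ∫⁻ ζ, ‖h.coeff τ ζ‖ₑ ^ 2 ≤ ∫⁻ ζ : ℝ³, ‖G (-ζ)‖ₑ ^ 2 := lintegral_mono_ae hae
    _ = ∫⁻ ζ, ‖G ζ‖ₑ ^ 2 := lintegral_neg_eq_self (fun ζ => ‖G ζ‖ₑ ^ 2)
    _ = eLpNorm (tensorField v τ) 2 volume ^ 2 := hP
    _ ≤ h.K ^ 2 := by
        gcongr
        exact h.eLpNorm_tensorField_le hτ

/-! ### The quadratic pairing -/

/-- **The quadratic pairing**: for `τ ∈ [0, T]`, a Schwartz function `θ` and indices `j, k`,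
`∫ θ(x) (v_j(τ,x) v_k(τ,x) : ℂ) dx = ∫ 𝓕θ(ζ) q(τ, ζ)_{jk} dζ` — the Plancherel duality
`∫ φ • 𝓕F = ∫ 𝓕φ • F` (`integral_smul_fourier_eq`) with `φ = 𝓕⁻¹θ`, `𝓕⁻¹θ(ξ) = 𝓕θ(-ξ)`, the
reflection `ξ ↦ -ξ`, and the `(j,k)` coordinate; this replaces the convolution pairing
`FujitaKato.DictHyp.quad` (Lemarié-Rieusset 2023, §8.7 (8.8): the transform of `u ⊗ u`). [cite: Lemarierieusset2023, §8.7 (8.8) (PDF p. 198)] -/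
theorem pairing {τ : ℝ} (hτ : τ ∈ Icc 0 T) (θ : SchwartzMap ℝ³ ℂ) (j k : Fin 3) :
    ∫ x, θ x * ((v τ x j * v τ x k : ℝ) : ℂ) = ∫ ζ, 𝓕 (θ : ℝ³ → ℂ) ζ * h.coeff τ ζ j k := by
  set hmem := h.memLp_complexify_tensorField hτ
  set Fτ := hmem.toLp _ with hFτ
  set G : ℝ³ → 𝕋ℂ := ((𝓕 Fτ : Lp 𝕋ℂ 2 (volume : Measure ℝ³)) : ℝ³ → 𝕋ℂ) with hG
  -- Plancherel duality with `φ = 𝓕⁻¹ θ`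
  have hdual := integral_smul_fourier_eq Fτ (𝓕⁻ θ)
  rw [fourier_fourierInv_eq] at hdual
  -- the left side: `𝓕⁻¹θ(ξ) = 𝓕θ(-ξ)` and reflection
  have hL : ∫ ξ, (𝓕⁻ θ : SchwartzMap ℝ³ ℂ) ξ • G ξ = ∫ ξ, 𝓕 (θ : ℝ³ → ℂ) ξ • G (-ξ) := by
    rw [← integral_neg_eq_self (fun ξ => 𝓕 (θ : ℝ³ → ℂ) ξ • G (-ξ)) volume]
    refine integral_congr_ae (Eventually.of_forall fun ξ => ?_)
    simp only [neg_neg]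
    rw [SchwartzMap.fourierInv_coe, Real.fourierInv_eq_fourier_neg]
  -- the right side: the `L²` class is the field
  have hR : ∫ x, (θ : ℝ³ → ℂ) x • (Fτ : ℝ³ → 𝕋ℂ) x = ∫ x, θ x • (complexify (tensorField v τ x)) :=
    integral_congr_ae (by
      filter_upwards [MemLp.coeFn_toLp hmem] with x hx
      rw [hx, Function.comp_apply])
  have hvec : ∫ ξ, 𝓕 (θ : ℝ³ → ℂ) ξ • G (-ξ) = ∫ x, θ x • complexify (tensorField v τ x) := by
    rw [← hL, hG, hdual, ← hR]
  -- integrability of both vector integrands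
  have hGm : MemLp (fun ξ => G (-ξ)) 2 (volume : Measure ℝ³) :=
    (Lp.memLp _).comp_measurePreserving (Measure.measurePreserving_neg (volume : Measure ℝ³))
  have hintL : Integrable (fun ξ => 𝓕 (θ : ℝ³ → ℂ) ξ • G (-ξ)) := by
    have := integrable_schwartz_smul (𝓕 θ) hGm
    simpa [SchwartzMap.fourier_coe] using this
  have hintR : Integrable (fun x => θ x • complexify (tensorField v τ x)) :=
    integrable_schwartz_smul θ hmem
  -- take the `(j,k)` coordinate
  have h1 := (EuclideanSpace.proj (𝕜 := ℂ) (j, k)).integral_comp_comm hintL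
  have h2 := (EuclideanSpace.proj (𝕜 := ℂ) (j, k)).integral_comp_comm hintR
  simp only [PiLp.proj_apply, WithLp.ofLp_smul, Pi.smul_apply, smul_eq_mul] at h1 h2
  have hproj := congrArg (fun z : 𝕋ℂ => z (j, k)) hvec
  simp only at hproj
  rw [← h1, ← h2] at hproj
  simp only [complexify_tensorProd_apply, tensorField_apply] at hproj
  rw [← hproj]
  refine integral_congr_ae ?_
  filter_upwards [h.coeff_ae_eq hτ] with ζ hζ
  rw [hζ j k]

end FieldHyp

end Field

/-! ### Summary: existence of a tensor coefficient field -/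

/-- **Tensor data of a bounded `C([0,T]; L³)` field.** For `v` bounded everywhere by `M ≥ 0` and
in `C([0,T]; L³(ℝ³))` there are a jointly measurable tensor coefficient field
`q : ℝ → ℝ³ → (Fin 3 → Fin 3 → ℂ)` and `K₂ < ∞` with: `∫ ‖q(τ,ζ)‖² dζ ≤ K₂` for `τ ∈ [0, T]`;
`q(τ, -ζ)_{jk} = conj q(τ, ζ)_{jk}` everywhere; and the quadratic pairing
`∫ θ (v_j v_k)(τ) = ∫ 𝓕θ q(τ)_{jk}` for Schwartz `θ`, `τ ∈ [0, T]`. [folklore] -/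
theorem exists_tensorData {v : ℝ → ℝ³ → ℝ³} {M T : ℝ} (hM : 0 ≤ M) (hb : ∀ τ x, ‖v τ x‖ ≤ M)
    (hc : ContinuousInLpOn (Icc 0 T) 3 v) :
    ∃ (q : ℝ → ℝ³ → Fin 3 → Fin 3 → ℂ) (K₂ : ℝ≥0∞), Measurable (uncurry q) ∧ K₂ ≠ ∞ ∧
      (∀ τ ∈ Icc 0 T, ∫⁻ ζ, ‖q τ ζ‖ₑ ^ 2 ≤ K₂) ∧
      (∀ τ ζ j k, q τ (-ζ) j k = conj (q τ ζ j k)) ∧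
      (∀ τ ∈ Icc 0 T, ∀ (θ : SchwartzMap ℝ³ ℂ) (j k : Fin 3),
        ∫ x, θ x * ((v τ x j * v τ x k : ℝ) : ℂ) = ∫ ζ, 𝓕 (θ : ℝ³ → ℂ) ζ * q τ ζ j k) := by
  have h : FieldHyp v M T := ⟨hM, hb, hc⟩
  exact ⟨h.coeff, h.K ^ 2, h.measurable_coeff, (ENNReal.pow_lt_top h.K_lt_top).ne,
    fun τ hτ => h.lintegral_coeff_sq_le hτ, h.coeff_neg, fun τ hτ θ j k => h.pairing hτ θ j k⟩

end Literature.Analysis.FluidPDE.Persistence
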